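import Literature.MathematicalPhysics.KineticTheory.EnskogRateMeanRung0BoundedMark
import Literature.Probability.Moments.PairSumVariance
import Literature.Probability.Moments.VarianceBookkeeping
import HarnessLib

/-!
# The Enskog rate functional has vanishing Gibbs variance at rung 0 for every continuous mark with a
# bounded sphere-integrated mark: the mean-square deviation of the Enskog integrand

Topic `Literature/MathematicalPhysics/KineticTheory` (kind proof; the static ENSKOG-side variance of the Enskog
closure at rung 0 for a GENERAL mark, wanted by the crux line `Sketch` of `InformationPercolationEngine.CollisionRate`,
stmt-AtomisticToContinuum-13481, registered stub `stub_fixedTimeVarianceUnitRung0`, whose mark is the speed-truncated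
unit mark `Ξ₁ᴸ(n, v, w) = ψ_L(‖w − v‖)`; companion of `EnskogRateMeanRung0BoundedMark`, which treats the MEAN).
Under the rung-0 local Gibbs law `G_N` (constant profiles `a, u, θ`; positions `posGibbsMeasure`, velocities i.i.d.
`N(u, θ id)`, independent) of `N + 1` hard spheres of diameter `σ(N+1)^{-1/3}` on `𝕋³`, for EVERY continuous mark `Ξ`
with `|Θ Ξ| ≤ C_Θ` and every `ψ` measurable, bounded by `K` on `[0, ∞)` and continuous at `σ³`:

* `variance_pi_pairFunctional_le_of_abs_sphereMark_le` — at fixed positions the pair functional `B_r Ξ` is an order-2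
  `U`-statistic of the i.i.d. velocities (any one-velocity probability law) with weights `O((N+1)⁻²)`, of variance
  `≤ 8M⁴C_Θ²/(N+1)` (`M = 3/(πr³)`; Efron–Stein, `variance_weightedPairSum_le`);
* `integral_sq_deviation_le_of_abs_sphereMark_le` — the mean-square deviation at a point `x₀ ∈ 𝕋³` of the Enskog
  integrand `ψ(σ³ρ_r(z,x₀)) B_r Ξ (z,x₀)` from the constant `ψ(σ³) Θ̄`, `Θ̄ = ∫ Θ Ξ d(N(u,θ) ⊗ N(u,θ))`, is at most
  `2K² · 8M⁴C_Θ²/(N+1) + 2Θ̄²(KM² + K)·[(K(M+1)+1)ε + C_{ε,δ} E_P(ρ̃_r(·,x₀) − 1)² + KM²/(N+1)]`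
  (pointwise split, deterministic estimate `abs_mul_offDiag_sub_le`, the velocity variance, the position marginal);
* `tendsto_integral_sq_deviation_of_abs_sphereMark_le`, `tendsto_integral_integral_sq_deviation_of_abs_sphereMark_le` —
  hence `J_N(x₀) → 0` at every `x₀` (uniform density LLN `tendsto_integral_sq_empDensity_sub_one`), boundedly
  (`measurable_integral_sq_deviation_and_le_of_abs_sphereMark_le`), so `∫ J_N → 0` (dominated convergence);
* `variance_enskogRate_le_sq_mul_integral_sq_deviation` — `Var_{G_N}(e_t) ≤ C_χ² ∫ J_N` for the Enskog rate
  functional `e_t(z) = ∫ χ(t,x) ψ(σ³ρ_r(z,x)) B_r Ξ (z,x) dx`, `ψ = g · Y`, `|χ(t, ·)| ≤ C_χ`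
  (`variance_integral_le_integral_integral_sq` with the centring `χ(t,x) ψ(σ³) Θ̄`).

Proofs adapted verbatim from the sibling crux's hard-wired versions
(`Theorems.EvenStressEnskog.integral_sq_deviation_le`, `…tendsto_integral_integral_sq_deviation`,
`…stub_enskogRateVarianceRung0`, truncated even marks).

References: H. van Beijeren, M. H. Ernst, Physica 68 (1973) [VanbeijerenErnst1973]; H. Spohn (1991) Part I §2.3
[Spohn1991]; S. Boucheron, O. Bousquet, G. Lugosi (2004) §2 [BoucheronBousquetLugosi2004].
-/

noncomputable section

namespace Literature.MathematicalPhysics.KineticTheory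

open MeasureTheory ProbabilityTheory Set Filter Topology Function
open scoped ENNReal InnerProductSpace BigOperators
open Literature.Analysis.FluidPDE Literature.MathematicalPhysics.StatisticalMechanics Literature.Probability.Moments

/-! ## Small measurability and summation facts -/

/-- The mollified density is jointly Borel measurable in `(z, x₀)`. [folklore] -/
theorem measurable_mollDensity_prod {N : ℕ} (r : ℝ) :
    Measurable fun q : Config (N + 1) (Fin 3) T3 × T3 => mollDensity r q.1 q.2 := by
  simp_rw [mollDensity_eq_avg]
  refine measurable_const.mul (Finset.measurable_sum _ fun i _ => ?_)
  exact measurable_coneKernel_comp r ((measurable_pi_apply i).comp measurable_fst).fst measurable_snd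

/-- The pair functional of a mark with jointly measurable sphere-integrated mark is jointly Borel measurable
in `(z, x₀)`. [folklore] -/
theorem measurable_pairFunctional_prod {N : ℕ} (r : ℝ) {Ξ : V3 × V3 × V3 → ℝ}
    (hΘm : Measurable fun p : V3 × V3 => sphereMark Ξ p.1 p.2) :
    Measurable fun q : Config (N + 1) (Fin 3) T3 × T3 => pairFunctional r Ξ q.1 q.2 := by
  simp_rw [pairFunctional_eq_double_sum]
  refine measurable_const.mul (Finset.measurable_sum _ fun i _ => Finset.measurable_sum _ fun j _ => ?_)
  refine ((measurable_coneKernel_comp r ((measurable_pi_apply i).comp measurable_fst).fst measurable_snd).mul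
    (measurable_coneKernel_comp r ((measurable_pi_apply j).comp measurable_fst).fst measurable_snd)).mul ?_
  exact hΘm.comp (((measurable_pi_apply i).comp measurable_fst).snd.prodMk
    ((measurable_pi_apply j).comp measurable_fst).snd)

/-- `|c · Σᵢ Σⱼ sᵢⱼ| ≤ c (N+1)² B` for `c ≥ 0`, `|sᵢⱼ| ≤ B`. [folklore] -/
theorem abs_const_mul_sum_sum_le_of_abs_le {N : ℕ} {c B : ℝ} (hc : 0 ≤ c) (s : Fin (N + 1) → Fin (N + 1) → ℝ)
    (hs : ∀ i j, |s i j| ≤ B) : |c * ∑ i, ∑ j, s i j| ≤ c * (((N + 1 : ℕ) : ℝ) ^ 2 * B) := by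
  rw [abs_mul, abs_of_nonneg hc]
  refine mul_le_mul_of_nonneg_left ?_ hc
  calc |∑ i, ∑ j, s i j| ≤ ∑ i, |∑ j, s i j| := Finset.abs_sum_le_sum_abs _ _
    _ ≤ ∑ i, ∑ j, |s i j| := Finset.sum_le_sum fun i _ => Finset.abs_sum_le_sum_abs _ _
    _ ≤ ∑ _i : Fin (N + 1), ∑ _j : Fin (N + 1), B := Finset.sum_le_sum fun i _ => Finset.sum_le_sum fun j _ => hs i j
    _ = ((N + 1 : ℕ) : ℝ) ^ 2 * B := by
        rw [Finset.sum_const, Finset.card_univ, Fintype.card_fin, nsmul_eq_mul, Finset.sum_const, Finset.card_univ,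
          Fintype.card_fin, nsmul_eq_mul]
        ring

/-- **Bochner disintegration at rung 0, iterated form**: for constant profiles `a > 0`, `θ > 0`, `u`, `σ ≤ 1/2`
(so that `P_N` is a probability measure) and an observable `G` integrable
under `G_N`, `∫ G dG_N = ∫ (∫ G (zipConfig (x, v)) d(⊗ᵢ N(u,θ))(v)) dP_N(x)` (`integral_localGibbsLaw_rung0`, Fubini).
[folklore] -/
theorem integral_localGibbsLaw_rung0_eq_integral_integral {σ a θ : ℝ} (hσ2 : σ ≤ 1 / 2) (ha : 0 < a) (hθ : 0 < θ)
    (u : V3) (N : ℕ) (Φ : HardSphereFlow (Torus.geometry (Fin 3)) (hsDiameter σ N) (N + 1))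
    {G : Config (N + 1) (Fin 3) T3 → ℝ}
    (hG : Integrable G (localGibbsLaw σ (fun _ => a) (fun _ => u) (fun _ => θ) N Φ)) :
    ∫ z, G z ∂(localGibbsLaw σ (fun _ => a) (fun _ => u) (fun _ => θ) N Φ) =
      ∫ x, ∫ v, G (zipConfig (x, v)) ∂(Measure.pi fun _ : Fin (N + 1) => gaussMeasure u θ)
        ∂posGibbsMeasure (fun _ : T3 => a) (hsDiameter σ N) (N + 1) := by
  haveI := isProbabilityMeasure_posGibbsMeasure continuous_const (fun _ : T3 => ha) hσ2 N
  rw [integral_localGibbsLaw_rung0 σ ha.le hθ u N Φ, integral_prod]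
  have hz : MeasurableEmbedding
      (zipConfig : (Fin (N + 1) → T3) × (Fin (N + 1) → V3) → Config (N + 1) (Fin 3) T3) :=
    (MeasurableEquiv.arrowProdEquivProdArrow T3 V3 (Fin (N + 1))).symm.measurableEmbedding
  rw [localGibbsLaw_eq, localGibbsMeasure_rung0_eq_map σ ha.le hθ u N] at hG
  exact (hz.integrable_map_iff).1 hG

/-- **The position marginal at rung 0**: `∫ F(x(z)) dG_N = ∫ F dP_N` for constant profiles (`a > 0`, `σ ≤ 1/2`).
[folklore] -/
theorem integral_localGibbsLaw_rung0_pos {σ a θ : ℝ} (hσ2 : σ ≤ 1 / 2) (ha : 0 < a) (hθ : 0 < θ) (u : V3) (N : ℕ)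
    (Φ : HardSphereFlow (Torus.geometry (Fin 3)) (hsDiameter σ N) (N + 1)) (F : (Fin (N + 1) → T3) → ℝ) :
    ∫ z, F (fun i => (z i).1) ∂(localGibbsLaw σ (fun _ => a) (fun _ => u) (fun _ => θ) N Φ) =
      ∫ x, F x ∂posGibbsMeasure (fun _ : T3 => a) (hsDiameter σ N) (N + 1) := by
  haveI := isProbabilityMeasure_posGibbsMeasure continuous_const (fun _ : T3 => ha) hσ2 N
  rw [integral_localGibbsLaw_rung0 σ ha.le hθ u N Φ]
  simp only [zipConfig_apply]
  rw [integral_fun_fst (fun x : Fin (N + 1) → T3 => F x), probReal_univ, one_smul]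

/-! ## The velocity `U`-statistic at fixed positions -/

/-- **Variance of the pair functional in the velocities, at fixed positions, general mark and general
one-velocity law.**  Under any product probability law `γ^{⊗(N+1)}` of the velocities the pair functional `B_r Ξ (zipConfig (x, v), x₀) = Σ_a Σ_b w_{ab} Θ(v_a, v_b)`,
`w_{ab} = (N+1)⁻² b_r(x_a,x₀) b_r(x_b,x₀)`, is a weighted pair sum with `|w| ≤ M²/(N+1)²`, `M = 3/(πr³)`, and
kernel `|Θ Ξ| ≤ C_Θ`; hence `Var ≤ 8 M⁴ C_Θ² / (N+1)` (`variance_weightedPairSum_le`). [folklore] -/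
theorem variance_pi_pairFunctional_le_of_abs_sphereMark_le {N : ℕ} (γ : Measure V3) [IsProbabilityMeasure γ]
    {Ξ : V3 × V3 × V3 → ℝ} (hΞc : Continuous Ξ) {CΘ : ℝ} (hΘb : ∀ v w, |sphereMark Ξ v w| ≤ CΘ) {r : ℝ} (hr : 0 < r)
    (xs : Fin (N + 1) → T3) (x₀ : T3) :
    variance (fun vs => pairFunctional r Ξ (zipConfig (xs, vs)) x₀) (Measure.pi fun _ : Fin (N + 1) => γ) ≤
      8 * (3 / (Real.pi * r ^ 3)) ^ 4 * CΘ ^ 2 * (((N + 1 : ℕ) : ℝ))⁻¹ := by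
  set M : ℝ := 3 / (Real.pi * r ^ 3) with hM
  set n : ℝ := ((N + 1 : ℕ) : ℝ) with hn
  have hn0 : 0 < n := by rw [hn]; positivity
  have hfun : (fun vs => pairFunctional r Ξ (zipConfig (xs, vs)) x₀) =
      fun vs : Fin (N + 1) → V3 => ∑ a, ∑ b, (n⁻¹ * n⁻¹ *
        (coneKernel r (xs a) x₀ * coneKernel r (xs b) x₀)) *
          (fun p : V3 × V3 => sphereMark Ξ p.1 p.2) (vs a, vs b) := by
    funext vs
    rw [pairFunctional_eq_double_sum, Finset.mul_sum]
    refine Finset.sum_congr rfl fun a _ => ?_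
    rw [Finset.mul_sum]
    refine Finset.sum_congr rfl fun b _ => ?_
    simp only [zipConfig_apply]
    ring
  have hΘm : Measurable fun p : V3 × V3 => sphereMark Ξ p.1 p.2 := (continuous_sphereMark_uncurry hΞc).measurable
  have hb : ∀ y : T3, 0 ≤ coneKernel r y x₀ ∧ coneKernel r y x₀ ≤ M := fun y => coneKernel_mem_Icc hr y x₀
  have hw : ∀ a b : Fin (N + 1),
      |n⁻¹ * n⁻¹ * (coneKernel r (xs a) x₀ * coneKernel r (xs b) x₀)| ≤ n⁻¹ * n⁻¹ * (M * M) := by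
    intro a b
    rw [abs_of_nonneg (mul_nonneg (mul_nonneg (inv_nonneg.2 hn0.le) (inv_nonneg.2 hn0.le))
      (mul_nonneg (hb _).1 (hb _).1))]
    exact mul_le_mul_of_nonneg_left (mul_le_mul (hb _).2 (hb _).2 (hb _).1
      ((hb (xs a)).1.trans (hb (xs a)).2)) (mul_nonneg (inv_nonneg.2 hn0.le) (inv_nonneg.2 hn0.le))
  rw [hfun]
  refine (variance_weightedPairSum_le (ι := Fin (N + 1)) γ hΘm
    (fun p => hΘb p.1 p.2) hw).trans (le_of_eq ?_)
  rw [Fintype.card_fin, ← hn]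
  field_simp

/-- `|Θ̄| ≤ C_Θ` for the Maxwellian pair average `Θ̄ = ∫ Θ Ξ d(N(u,θ) ⊗ N(u,θ))` of a mark with
`|Θ Ξ| ≤ C_Θ`. [folklore] -/
theorem abs_integral_sphereMark_le_of_abs_sphereMark_le (u : V3) (θ : ℝ) {Ξ : V3 × V3 × V3 → ℝ} {CΘ : ℝ}
    (hΘb : ∀ v w, |sphereMark Ξ v w| ≤ CΘ) :
    |∫ p, sphereMark Ξ p.1 p.2 ∂((gaussMeasure u θ).prod (gaussMeasure u θ))| ≤ CΘ := by
  have h := norm_integral_le_of_norm_le_const (μ := (gaussMeasure u θ).prod (gaussMeasure u θ))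
    (f := fun p : V3 × V3 => sphereMark Ξ p.1 p.2) (C := CΘ)
    (ae_of_all _ fun p => by rw [Real.norm_eq_abs]; exact hΘb p.1 p.2)
  simpa only [Real.norm_eq_abs, probReal_univ, mul_one] using h

/-! ## The mean-square deviation at one point of the torus -/

/-- **The mean-square deviation at one point, bounded, general mark.**  Under the rung-0 local Gibbs law,
for `ψ` measurable with `|ψ| ≤ K` on `[0, ∞)` and `|ψ y − ψ(σ³)| < ε` for `|y − σ³| < δ`, a continuous mark
with `|Θ Ξ| ≤ C_Θ`, at every `x₀ ∈ 𝕋³`: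
`E_G[(ψ(σ³ρ_r) B_r − ψ(σ³)Θ̄)²] ≤ 2K² · 8M⁴C_Θ²/(N+1) + 2Θ̄²(KM² + K)·[(K(M+1)+1)ε + C_{ε,δ} E_P(ρ̃_r − 1)² + KM²/(N+1)]`
— a pointwise split, the deterministic estimate `abs_mul_offDiag_sub_le`, the velocity variance
`variance_pi_pairFunctional_le_of_abs_sphereMark_le` (positions and velocities being independent at rung 0) and the
position marginal. [folklore] -/
theorem integral_sq_deviation_le_of_abs_sphereMark_le {σ a θ : ℝ} {u : V3} (hσ : 0 < σ) (hσ2 : σ ≤ 1 / 2)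
    (ha : 0 < a) (hθ : 0 < θ) {ψ : ℝ → ℝ} (hψm : Measurable ψ) {K : ℝ} (hK : ∀ y, 0 ≤ y → |ψ y| ≤ K)
    {ε δ : ℝ} (hε : 0 < ε) (hδ : 0 < δ) (hcont : ∀ y, |y - σ ^ 3| < δ → |ψ y - ψ (σ ^ 3)| < ε)
    {Ξ : V3 × V3 × V3 → ℝ} (hΞc : Continuous Ξ) {CΘ : ℝ} (hΘb : ∀ v w, |sphereMark Ξ v w| ≤ CΘ)
    {r : ℝ} (hr : 0 < r) (x₀ : T3) (N : ℕ)
    (Φ : HardSphereFlow (Torus.geometry (Fin 3)) (hsDiameter σ N) (N + 1)) :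
    ∫ z, (ψ (σ ^ 3 * mollDensity r z x₀) * pairFunctional r Ξ z x₀ -
        ψ (σ ^ 3) * ∫ p, sphereMark Ξ p.1 p.2 ∂((gaussMeasure u θ).prod (gaussMeasure u θ))) ^ 2
        ∂(localGibbsLaw σ (fun _ => a) (fun _ => u) (fun _ => θ) N Φ) ≤
      2 * K ^ 2 * (8 * (3 / (Real.pi * r ^ 3)) ^ 4 * CΘ ^ 2 * (((N + 1 : ℕ) : ℝ))⁻¹) +
      2 * (∫ p, sphereMark Ξ p.1 p.2 ∂((gaussMeasure u θ).prod (gaussMeasure u θ))) ^ 2 *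
        (K * ((3 / (Real.pi * r ^ 3)) * (3 / (Real.pi * r ^ 3))) + K) *
        ((K * (3 / (Real.pi * r ^ 3) + 1) + 1) * ε +
          (K * (3 / (Real.pi * r ^ 3) + 1) / (4 * ε) + 2 * K * (σ ^ 3) ^ 2 / δ ^ 2) *
            ∫ xs, (empDensity r xs x₀ - 1) ^ 2 ∂posGibbsMeasure (fun _ : T3 => a) (hsDiameter σ N) (N + 1) +
          K * (3 / (Real.pi * r ^ 3)) ^ 2 * (((N + 1 : ℕ) : ℝ))⁻¹) := by
  set s : ℝ := σ ^ 3 with hs_def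
  set M : ℝ := 3 / (Real.pi * r ^ 3) with hM
  set n : ℝ := ((N + 1 : ℕ) : ℝ) with hn
  set Γ : Measure (Fin (N + 1) → V3) := Measure.pi fun _ : Fin (N + 1) => gaussMeasure u θ with hΓ
  set P := posGibbsMeasure (fun _ : T3 => a) (hsDiameter σ N) (N + 1) with hP
  set G := localGibbsLaw σ (fun _ => a) (fun _ => u) (fun _ => θ) N Φ with hG
  set Θb : ℝ := ∫ p, sphereMark Ξ p.1 p.2 ∂((gaussMeasure u θ).prod (gaussMeasure u θ)) with hΘbdef
  set A : ℝ := K * (M + 1) + 1 with hA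
  set C' : ℝ := K * (M + 1) / (4 * ε) + 2 * K * s ^ 2 / δ ^ 2 with hC'
  set D : ℝ := K * (M * M) + K with hD
  set b : Config (N + 1) (Fin 3) T3 → Fin (N + 1) → ℝ := fun z i => coneKernel r (z i).1 x₀ with hb
  set Q : Config (N + 1) (Fin 3) T3 → ℝ := fun z =>
    n⁻¹ * n⁻¹ * ∑ i, ∑ j, (if i = j then 0 else b z i * b z j) with hQ
  set pF := pairFunctional (N := N) r Ξ with hpF
  haveI : IsProbabilityMeasure G := isProbabilityMeasure_localGibbsLaw continuous_const
    continuous_const continuous_const (fun _ => ha) (fun _ => hθ) hσ2 N Φ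
  haveI : IsProbabilityMeasure P := isProbabilityMeasure_posGibbsMeasure continuous_const (fun _ => ha) hσ2 N
  have hs : 0 < s := pow_pos hσ 3
  have hn0 : 0 < n := by rw [hn]; positivity
  have hK0 : 0 ≤ K := (abs_nonneg _).trans (hK 0 le_rfl)
  have hbM : ∀ z i, 0 ≤ b z i ∧ b z i ≤ M := fun z i => coneKernel_mem_Icc hr (z i).1 x₀
  have hM0 : 0 ≤ M := by rw [hM]; positivity
  have hD0 : 0 ≤ D := by rw [hD]; positivity
  have hCΘ0 : 0 ≤ CΘ := (abs_nonneg _).trans (hΘb 0 0)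
  have hΘb' : |Θb| ≤ CΘ := abs_integral_sphereMark_le_of_abs_sphereMark_le u θ hΘb
  have hΘm : Measurable fun p : V3 × V3 => sphereMark Ξ p.1 p.2 := (continuous_sphereMark_uncurry hΞc).measurable
  -- uniform bounds on `B_r` and `Q`
  have hpFabs : ∀ z, |pF z x₀| ≤ M * M * CΘ := fun z => by
    have h := abs_pairFunctional_le_sq_mul_of_abs_sphereMark_le (N := N) hΘb hr z x₀
    rw [sq] at h
    exact h
  have hQabs : ∀ z, |Q z| ≤ M * M := fun z => by
    simp only [hQ]
    refine (abs_const_mul_sum_sum_le_of_abs_le (B := M * M) (mul_nonneg (inv_nonneg.2 hn0.le) (inv_nonneg.2 hn0.le))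
      _ fun i j => ?_).trans (le_of_eq ?_)
    · split_ifs
      · rw [abs_zero]; exact mul_nonneg hM0 hM0
      · rw [abs_mul, abs_of_nonneg (hbM z i).1, abs_of_nonneg (hbM z j).1]
        exact mul_le_mul (hbM z i).2 (hbM z j).2 (hbM z j).1 hM0
    · rw [hn]
      field_simp
  -- the mollified density as a sum, and the deterministic estimate
  have hρsum : ∀ z : Config (N + 1) (Fin 3) T3, mollDensity r z x₀ = n⁻¹ * ∑ i, b z i := fun z => by
    rw [mollDensity_eq_avg]
  have hρ0 : ∀ z : Config (N + 1) (Fin 3) T3, 0 ≤ s * mollDensity r z x₀ := fun z =>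
    mul_nonneg hs.le (mollDensity_nonneg_of_pos hr z x₀)
  have hdev : ∀ z : Config (N + 1) (Fin 3) T3, |ψ (s * mollDensity r z x₀) * Q z - ψ s| ≤
      A * ε + C' * (mollDensity r z x₀ - 1) ^ 2 + K * M ^ 2 * n⁻¹ := fun z => by
    rw [hρsum]
    exact abs_mul_offDiag_sub_le hK hM0 hs hε hδ hcont (b z) (hbM z)
  have hDz : ∀ z : Config (N + 1) (Fin 3) T3, |ψ (s * mollDensity r z x₀) * Q z - ψ s| ≤ D := fun z => by
    refine (abs_sub _ _).trans (add_le_add ?_ (hK s hs.le))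
    rw [abs_mul]
    exact mul_le_mul (hK _ (hρ0 z)) (hQabs z) (abs_nonneg _) hK0
  -- the pointwise bound: `(ψ₁B − ψ₀Θ̄)² ≤ 2K²(B − Θ̄Q)² + 2Θ̄²D·|ψ₁Q − ψ₀|`
  have hsqsplit : ∀ {ψ₁ ψ₀ B Q' D' : ℝ}, |ψ₁| ≤ K → |ψ₁ * Q' - ψ₀| ≤ D' →
      (ψ₁ * B - ψ₀ * Θb) ^ 2 ≤ 2 * K ^ 2 * (B - Θb * Q') ^ 2 + 2 * Θb ^ 2 * D' * |ψ₁ * Q' - ψ₀| := by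
    intro ψ₁ ψ₀ B Q' D' hψ₁ hD'
    have e : ψ₁ * B - ψ₀ * Θb = ψ₁ * (B - Θb * Q') + Θb * (ψ₁ * Q' - ψ₀) := by ring
    have h1 : (ψ₁ * (B - Θb * Q')) ^ 2 ≤ K ^ 2 * (B - Θb * Q') ^ 2 := by
      rw [mul_pow]
      refine mul_le_mul_of_nonneg_right ?_ (sq_nonneg _)
      rw [← sq_abs]
      exact pow_le_pow_left₀ (abs_nonneg _) hψ₁ 2
    have h2 : (Θb * (ψ₁ * Q' - ψ₀)) ^ 2 ≤ Θb ^ 2 * (D' * |ψ₁ * Q' - ψ₀|) := by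
      rw [mul_pow]
      refine mul_le_mul_of_nonneg_left ?_ (sq_nonneg _)
      rw [← sq_abs, sq]
      exact mul_le_mul_of_nonneg_right hD' (abs_nonneg _)
    rw [e]
    nlinarith [h1, h2, sq_nonneg (ψ₁ * (B - Θb * Q') - Θb * (ψ₁ * Q' - ψ₀))]
  have hpt : ∀ z : Config (N + 1) (Fin 3) T3, (ψ (s * mollDensity r z x₀) * pF z x₀ - ψ s * Θb) ^ 2 ≤
      2 * K ^ 2 * (pF z x₀ - Θb * Q z) ^ 2 + 2 * Θb ^ 2 * D *
        (A * ε + C' * (mollDensity r z x₀ - 1) ^ 2 + K * M ^ 2 * n⁻¹) := fun z => by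
    refine (hsqsplit (hK _ (hρ0 z)) (hDz z)).trans ?_
    exact add_le_add le_rfl (mul_le_mul_of_nonneg_left (hdev z)
      (mul_nonneg (mul_nonneg zero_le_two (sq_nonneg _)) hD0))
  -- measurability of the pieces
  have hbm : ∀ i : Fin (N + 1), Measurable fun z : Config (N + 1) (Fin 3) T3 => b z i := fun i =>
    measurable_coneKernel_comp r (measurable_pi_apply i).fst measurable_const
  have hzx : Measurable fun z : Config (N + 1) (Fin 3) T3 => (z, x₀) := measurable_id.prodMk measurable_const
  have hρm : Measurable fun z : Config (N + 1) (Fin 3) T3 => mollDensity r z x₀ := by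
    have h := (measurable_mollDensity_prod (N := N) r).comp hzx
    exact h
  have hpFm : Measurable fun z : Config (N + 1) (Fin 3) T3 => pF z x₀ := by
    have h := (measurable_pairFunctional_prod (N := N) r hΘm).comp hzx
    exact h
  have hQm : Measurable Q := by
    refine measurable_const.mul (Finset.measurable_sum _ fun i _ => Finset.measurable_sum _ fun j _ => ?_)
    split_ifs
    · exact measurable_const
    · exact (hbm i).mul (hbm j)
  have hLm : Measurable fun z : Config (N + 1) (Fin 3) T3 =>
      (ψ (s * mollDensity r z x₀) * pF z x₀ - ψ s * Θb) ^ 2 :=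
    (((hψm.comp (hρm.const_mul _)).mul hpFm).sub measurable_const).pow_const 2
  have hLb : ∀ z : Config (N + 1) (Fin 3) T3,
      |(ψ (s * mollDensity r z x₀) * pF z x₀ - ψ s * Θb) ^ 2| ≤ (K * (M * M * CΘ) + K * CΘ) ^ 2 := fun z => by
    rw [abs_pow]
    refine pow_le_pow_left₀ (abs_nonneg _) ((abs_sub _ _).trans (add_le_add ?_ ?_)) 2
    · rw [abs_mul]; exact mul_le_mul (hK _ (hρ0 z)) (hpFabs z) (abs_nonneg _) hK0
    · rw [abs_mul]; exact mul_le_mul (hK _ hs.le) hΘb' (abs_nonneg _) hK0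
  have hLi : Integrable (fun z => (ψ (s * mollDensity r z x₀) * pF z x₀ - ψ s * Θb) ^ 2) G :=
    Integrable.of_bound hLm.aestronglyMeasurable _ (ae_of_all _ fun z => by rw [Real.norm_eq_abs]; exact hLb z)
  have hαm : Measurable fun z : Config (N + 1) (Fin 3) T3 => (pF z x₀ - Θb * Q z) ^ 2 :=
    (hpFm.sub (hQm.const_mul _)).pow_const 2
  have hαb : ∀ z, |(pF z x₀ - Θb * Q z) ^ 2| ≤ (M * M * CΘ + CΘ * (M * M)) ^ 2 := fun z => by
    rw [abs_pow]
    refine pow_le_pow_left₀ (abs_nonneg _) ((abs_sub _ _).trans (add_le_add (hpFabs z) ?_)) 2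
    rw [abs_mul]; exact mul_le_mul hΘb' (hQabs z) (abs_nonneg _) hCΘ0
  have hαi : Integrable (fun z => (pF z x₀ - Θb * Q z) ^ 2) G :=
    Integrable.of_bound hαm.aestronglyMeasurable _ (ae_of_all _ fun z => by rw [Real.norm_eq_abs]; exact hαb z)
  have hVm : Measurable fun z : Config (N + 1) (Fin 3) T3 => (mollDensity r z x₀ - 1) ^ 2 :=
    (hρm.sub measurable_const).pow_const 2
  have hVb : ∀ z : Config (N + 1) (Fin 3) T3, |(mollDensity r z x₀ - 1) ^ 2| ≤ (M + 1) ^ 2 := fun z => by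
    rw [abs_pow]
    refine pow_le_pow_left₀ (abs_nonneg _) ((abs_sub _ _).trans (add_le_add ?_ (by norm_num))) 2
    rw [abs_of_nonneg (mollDensity_nonneg_of_pos hr z x₀), hρsum]
    calc n⁻¹ * ∑ i, b z i ≤ n⁻¹ * ∑ _i : Fin (N + 1), M :=
          mul_le_mul_of_nonneg_left (Finset.sum_le_sum fun i _ => (hbM z i).2) (inv_nonneg.2 hn0.le)
      _ = M := by
          rw [Finset.sum_const, Finset.card_univ, Fintype.card_fin, nsmul_eq_mul, ← hn, ← mul_assoc,
            inv_mul_cancel₀ hn0.ne', one_mul]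
  have hVi : Integrable (fun z => (mollDensity r z x₀ - 1) ^ 2) G :=
    Integrable.of_bound hVm.aestronglyMeasurable _ (ae_of_all _ fun z => by rw [Real.norm_eq_abs]; exact hVb z)
  -- (i) the velocity variance term
  have hAterm : ∫ z, (pF z x₀ - Θb * Q z) ^ 2 ∂G ≤ 8 * M ^ 4 * CΘ ^ 2 * n⁻¹ := by
    rw [hG, integral_localGibbsLaw_rung0_eq_integral_integral hσ2 ha hθ u N Φ hαi]
    have hinner : ∀ xs : Fin (N + 1) → T3,
        ∫ vs, (pF (zipConfig (xs, vs)) x₀ - Θb * Q (zipConfig (xs, vs))) ^ 2 ∂Γ ≤ 8 * M ^ 4 * CΘ ^ 2 * n⁻¹ := by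
      intro xs
      -- the left side is the velocity variance of `B_r` at fixed positions (`integral_vel_pairFunctional_of_measurable`)
      have hXm : Measurable fun vs : Fin (N + 1) → V3 => pairFunctional r Ξ (zipConfig (xs, vs)) x₀ := by
        have h := (measurable_pairFunctional_prod (N := N) r hΘm).comp
          ((measurable_zipConfig.comp (measurable_const.prodMk measurable_id)).prodMk measurable_const :
            Measurable fun vs : Fin (N + 1) → V3 => (zipConfig (xs, vs), x₀))
        exact h
      have hv := variance_eq_integral (μ := Γ) hXm.aemeasurable
      rw [hΓ, integral_vel_pairFunctional_of_measurable u θ hΘm hΘb r xs x₀] at hv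
      have h := variance_pi_pairFunctional_le_of_abs_sphereMark_le (gaussMeasure u θ) hΞc hΘb hr xs x₀
      rw [hv] at h
      simpa only [hpF, hQ, hb, zipConfig_apply] using h
    calc ∫ xs, ∫ vs, (pF (zipConfig (xs, vs)) x₀ - Θb * Q (zipConfig (xs, vs))) ^ 2 ∂Γ ∂P
        ≤ ∫ _xs, 8 * M ^ 4 * CΘ ^ 2 * n⁻¹ ∂P :=
          integral_mono_of_nonneg (ae_of_all _ fun xs => integral_nonneg fun vs => sq_nonneg _)
            (integrable_const _) (ae_of_all _ hinner)
      _ = 8 * M ^ 4 * CΘ ^ 2 * n⁻¹ := by rw [integral_const, smul_eq_mul, probReal_univ, one_mul]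
  -- (ii) the position variance term
  have hVterm : ∫ z, (mollDensity r z x₀ - 1) ^ 2 ∂G = ∫ xs, (empDensity r xs x₀ - 1) ^ 2 ∂P := by
    have h := integral_localGibbsLaw_rung0_pos hσ2 ha hθ u N Φ (fun xs => (empDensity r xs x₀ - 1) ^ 2)
    refine (integral_congr_ae (ae_of_all _ fun z => ?_)).trans h
    simp only [hρsum, empDensity, hb, hn]
  -- assemble
  have hI1 : Integrable (fun z => 2 * K ^ 2 * (pF z x₀ - Θb * Q z) ^ 2) G := hαi.const_mul _
  have hI2 : Integrable (fun z : Config (N + 1) (Fin 3) T3 => C' * (mollDensity r z x₀ - 1) ^ 2) G :=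
    hVi.const_mul _
  have hI3 : Integrable (fun z : Config (N + 1) (Fin 3) T3 => A * ε + C' * (mollDensity r z x₀ - 1) ^ 2) G :=
    (integrable_const _).add hI2
  have hI4 : Integrable (fun z : Config (N + 1) (Fin 3) T3 =>
      A * ε + C' * (mollDensity r z x₀ - 1) ^ 2 + K * M ^ 2 * n⁻¹) G := hI3.add (integrable_const _)
  have hI5 : Integrable (fun z : Config (N + 1) (Fin 3) T3 =>
      2 * Θb ^ 2 * D * (A * ε + C' * (mollDensity r z x₀ - 1) ^ 2 + K * M ^ 2 * n⁻¹)) G := hI4.const_mul _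
  have hI6 : Integrable (fun z => 2 * K ^ 2 * (pF z x₀ - Θb * Q z) ^ 2 +
      2 * Θb ^ 2 * D * (A * ε + C' * (mollDensity r z x₀ - 1) ^ 2 + K * M ^ 2 * n⁻¹)) G := hI1.add hI5
  have hstep : ∫ z, (2 * K ^ 2 * (pF z x₀ - Θb * Q z) ^ 2 +
      2 * Θb ^ 2 * D * (A * ε + C' * (mollDensity r z x₀ - 1) ^ 2 + K * M ^ 2 * n⁻¹)) ∂G =
      2 * K ^ 2 * ∫ z, (pF z x₀ - Θb * Q z) ^ 2 ∂G + 2 * Θb ^ 2 * D *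
        (A * ε + C' * ∫ z, (mollDensity r z x₀ - 1) ^ 2 ∂G + K * M ^ 2 * n⁻¹) := by
    rw [integral_add hI1 hI5, integral_const_mul, integral_const_mul, integral_add hI3 (integrable_const _),
      integral_add (integrable_const _) hI2, integral_const_mul, integral_const, integral_const,
      smul_eq_mul, smul_eq_mul, probReal_univ, one_mul, one_mul, integral_const_mul]
  calc ∫ z, (ψ (s * mollDensity r z x₀) * pF z x₀ - ψ s * Θb) ^ 2 ∂G
      ≤ ∫ z, (2 * K ^ 2 * (pF z x₀ - Θb * Q z) ^ 2 + 2 * Θb ^ 2 * D *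
          (A * ε + C' * (mollDensity r z x₀ - 1) ^ 2 + K * M ^ 2 * n⁻¹)) ∂G := integral_mono hLi hI6 hpt
    _ ≤ 2 * K ^ 2 * (8 * M ^ 4 * CΘ ^ 2 * n⁻¹) + 2 * Θb ^ 2 * D *
          (A * ε + C' * ∫ xs, (empDensity r xs x₀ - 1) ^ 2 ∂P + K * M ^ 2 * n⁻¹) := by
        rw [hstep, hVterm]
        exact add_le_add (mul_le_mul_of_nonneg_left hAterm (by positivity)) le_rfl

/-- **The mean-square deviation at one point tends to zero** as `N → ∞`, for the uniform gas at small
reduced density, `ψ` bounded on `[0, ∞)`, measurable and continuous at `σ³`, a continuous mark with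
`|Θ Ξ| ≤ C_Θ`, `0 < r < 1/2` (port of `Theorems.EvenStressEnskog.tendsto_integral_sq_deviation`). [folklore] -/
theorem tendsto_integral_sq_deviation_of_abs_sphereMark_le {σ a θ : ℝ} {u : V3} (hsd : SmallDensity uniformProfile σ)
    (ha : 0 < a) (hθ : 0 < θ) {ψ : ℝ → ℝ} (hψm : Measurable ψ) {K : ℝ} (hK : ∀ y, 0 ≤ y → |ψ y| ≤ K)
    (hψc : ContinuousAt ψ (σ ^ 3)) {Ξ : V3 × V3 × V3 → ℝ} (hΞc : Continuous Ξ) {CΘ : ℝ}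
    (hΘb : ∀ v w, |sphereMark Ξ v w| ≤ CΘ) {r : ℝ} (hr : 0 < r) (hr2 : r < 1 / 2)
    (x₀ : T3) (Φ : (N : ℕ) → HardSphereFlow (Torus.geometry (Fin 3)) (hsDiameter σ N) (N + 1)) :
    Tendsto (fun N : ℕ => ∫ z, (ψ (σ ^ 3 * mollDensity r z x₀) * pairFunctional r Ξ z x₀ -
        ψ (σ ^ 3) * ∫ p, sphereMark Ξ p.1 p.2
          ∂((gaussMeasure u θ).prod (gaussMeasure u θ))) ^ 2
        ∂(localGibbsLaw σ (fun _ => a) (fun _ => u) (fun _ => θ) N (Φ N))) atTop (𝓝 0) := by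
  have hσ : 0 < σ := hsd.σ_pos
  have hσ2 : σ ≤ 1 / 2 := hsd.σ_lt_half.le
  set M : ℝ := 3 / (Real.pi * r ^ 3) with hM
  set Θb : ℝ := ∫ p, sphereMark Ξ p.1 p.2 ∂((gaussMeasure u θ).prod (gaussMeasure u θ))
    with hΘbdef
  have hK0 : 0 ≤ K := (abs_nonneg _).trans (hK 0 le_rfl)
  have hM0 : 0 ≤ M := by rw [hM]; positivity
  set D : ℝ := K * (M * M) + K with hD
  set A : ℝ := K * (M + 1) + 1 with hA
  set β : ℝ := 2 * Θb ^ 2 * D with hβ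
  have hD0 : 0 ≤ D := by rw [hD]; positivity
  have hA0 : 0 < A := by rw [hA]; positivity
  have hβ0 : 0 ≤ β := by rw [hβ]; positivity
  set V : ℕ → ℝ := fun N => ∫ xs, (empDensity r xs x₀ - 1) ^ 2
    ∂posGibbsMeasure (fun _ : T3 => a) (hsDiameter σ N) (N + 1) with hV
  have hVlim : Tendsto V atTop (𝓝 0) := tendsto_integral_sq_empDensity_sub_one hsd ha hr hr2 x₀
  have h1 : Tendsto (fun N : ℕ => (((N + 1 : ℕ) : ℝ))⁻¹) atTop (𝓝 0) :=
    tendsto_inv_atTop_zero.comp ((tendsto_natCast_atTop_atTop (R := ℝ)).comp (tendsto_add_atTop_nat 1))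
  rw [Metric.tendsto_atTop]
  intro η hη
  set ε : ℝ := η / (2 * (β * A + 1)) with hε
  have hε0 : 0 < ε := by rw [hε]; positivity
  obtain ⟨δ, hδ, hδε⟩ := Metric.continuousAt_iff.1 hψc ε hε0
  set C' : ℝ := K * (M + 1) / (4 * ε) + 2 * K * (σ ^ 3) ^ 2 / δ ^ 2 with hC'
  have hR : Tendsto (fun N : ℕ => 2 * K ^ 2 * (8 * M ^ 4 * CΘ ^ 2 * (((N + 1 : ℕ) : ℝ))⁻¹) +
      β * (C' * V N + K * M ^ 2 * (((N + 1 : ℕ) : ℝ))⁻¹)) atTop (𝓝 0) := by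
    have h := ((h1.const_mul (8 * M ^ 4 * CΘ ^ 2)).const_mul (2 * K ^ 2)).add
      (((hVlim.const_mul C').add (h1.const_mul (K * M ^ 2))).const_mul β)
    simpa only [mul_zero, add_zero] using h
  obtain ⟨N₀, hN₀⟩ := Metric.tendsto_atTop.1 hR (η / 2) (by positivity)
  refine ⟨N₀, fun N hN => ?_⟩
  have hJ := integral_sq_deviation_le_of_abs_sphereMark_le (u := u) hσ hσ2 ha hθ hψm hK hε0 hδ
    (fun y hy => hδε hy) hΞc hΘb hr x₀ N (Φ N)
  have hRN := hN₀ N hN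
  rw [Real.dist_eq, sub_zero] at hRN
  have hAε : β * (A * ε) ≤ η / 2 := by
    have e : β * (A * ε) = η / 2 * (β * A / (β * A + 1)) := by
      rw [hε]; field_simp
    rw [e]
    have h2 : β * A / (β * A + 1) ≤ 1 := (div_le_one (by positivity)).2 (by linarith)
    calc η / 2 * (β * A / (β * A + 1)) ≤ η / 2 * 1 := mul_le_mul_of_nonneg_left h2 (by positivity)
      _ = η / 2 := mul_one _
  rw [Real.dist_eq, sub_zero, abs_of_nonneg (integral_nonneg fun z => sq_nonneg _)]
  calc _ ≤ _ := hJ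
    _ = β * (A * ε) + (2 * K ^ 2 * (8 * M ^ 4 * CΘ ^ 2 * (((N + 1 : ℕ) : ℝ))⁻¹) +
          β * (C' * V N + K * M ^ 2 * (((N + 1 : ℕ) : ℝ))⁻¹)) := by ring
    _ < η / 2 + η / 2 := add_lt_add_of_le_of_lt hAε ((le_abs_self _).trans_lt hRN)
    _ = η := by ring

/-- Joint measurability of `(z, x₀) ↦ (ψ(σ³ρ_r(z,x₀)) B_r Ξ (z,x₀) − c)²` for measurable `ψ` and a continuous
mark `Ξ` (continuity of `ρ_r`, `B_r` in `(z, x₀)`). [folklore] -/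
theorem measurable_sq_deviation_of_continuous (σ : ℝ) (N : ℕ) {ψ : ℝ → ℝ} (hψm : Measurable ψ)
    {Ξ : V3 × V3 × V3 → ℝ} (hΞc : Continuous Ξ) (r c : ℝ) :
    Measurable fun q : Config (N + 1) (Fin 3) T3 × T3 =>
      (ψ (σ ^ 3 * mollDensity r q.1 q.2) * pairFunctional r Ξ q.1 q.2 - c) ^ 2 :=
  (((hψm.comp ((measurable_mollDensity_prod r).const_mul _)).mul (measurable_pairFunctional_prod r
    (continuous_sphereMark_uncurry hΞc).measurable)).sub measurable_const).pow_const 2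

/-- **The mean-square deviation is a bounded measurable function of the point `x₀`** (general continuous mark
with `|Θ Ξ| ≤ C_Θ`): measurable as a parametric integral, and bounded by `(K M² C_Θ + K C_Θ)²` under the
(probability) local Gibbs law, `σ ≤ 1/2`. [folklore] -/
theorem measurable_integral_sq_deviation_and_le_of_abs_sphereMark_le {σ a θ : ℝ} {u : V3} (hσ : 0 < σ)
    (hσ2 : σ ≤ 1 / 2) (ha : 0 < a) (hθ : 0 < θ) {ψ : ℝ → ℝ} (hψm : Measurable ψ) {K : ℝ}
    (hK : ∀ y, 0 ≤ y → |ψ y| ≤ K) {Ξ : V3 × V3 × V3 → ℝ} (hΞc : Continuous Ξ) {CΘ : ℝ}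
    (hΘb : ∀ v w, |sphereMark Ξ v w| ≤ CΘ) {r : ℝ} (hr : 0 < r) (N : ℕ)
    (Φ : HardSphereFlow (Torus.geometry (Fin 3)) (hsDiameter σ N) (N + 1)) :
    Measurable (fun x₀ : T3 => ∫ z, (ψ (σ ^ 3 * mollDensity r z x₀) * pairFunctional r Ξ z x₀ -
        ψ (σ ^ 3) * ∫ p, sphereMark Ξ p.1 p.2
          ∂((gaussMeasure u θ).prod (gaussMeasure u θ))) ^ 2
        ∂(localGibbsLaw σ (fun _ => a) (fun _ => u) (fun _ => θ) N Φ)) ∧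
    ∀ x₀ : T3, ∫ z, (ψ (σ ^ 3 * mollDensity r z x₀) * pairFunctional r Ξ z x₀ -
        ψ (σ ^ 3) * ∫ p, sphereMark Ξ p.1 p.2
          ∂((gaussMeasure u θ).prod (gaussMeasure u θ))) ^ 2
        ∂(localGibbsLaw σ (fun _ => a) (fun _ => u) (fun _ => θ) N Φ) ≤
      (K * ((3 / (Real.pi * r ^ 3)) * (3 / (Real.pi * r ^ 3)) * CΘ) + K * CΘ) ^ 2 := by
  set M : ℝ := 3 / (Real.pi * r ^ 3) with hM
  set G := localGibbsLaw σ (fun _ => a) (fun _ => u) (fun _ => θ) N Φ with hG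
  set Θb : ℝ := ∫ p, sphereMark Ξ p.1 p.2 ∂((gaussMeasure u θ).prod (gaussMeasure u θ)) with hΘbdef
  haveI : IsProbabilityMeasure G := isProbabilityMeasure_localGibbsLaw continuous_const
    continuous_const continuous_const (fun _ => ha) (fun _ => hθ) hσ2 N Φ
  have hK0 : 0 ≤ K := (abs_nonneg _).trans (hK 0 le_rfl)
  have hM0 : 0 ≤ M := by rw [hM]; positivity
  have hΘb' : |Θb| ≤ CΘ := abs_integral_sphereMark_le_of_abs_sphereMark_le u θ hΘb
  have hpFabs : ∀ (z : Config (N + 1) (Fin 3) T3) (x₀ : T3), |pairFunctional r Ξ z x₀| ≤ M * M * CΘ :=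
    fun z x₀ => by
      have h := abs_pairFunctional_le_sq_mul_of_abs_sphereMark_le (N := N) hΘb hr z x₀
      rw [sq] at h
      exact h
  have hb : ∀ (z : Config (N + 1) (Fin 3) T3) (x₀ : T3),
      |(ψ (σ ^ 3 * mollDensity r z x₀) * pairFunctional r Ξ z x₀ - ψ (σ ^ 3) * Θb) ^ 2| ≤
        (K * (M * M * CΘ) + K * CΘ) ^ 2 := by
    intro z x₀
    rw [abs_pow]
    refine pow_le_pow_left₀ (abs_nonneg _) ((abs_sub _ _).trans (add_le_add ?_ ?_)) 2
    · rw [abs_mul]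
      exact mul_le_mul (hK _ (mul_nonneg (pow_nonneg hσ.le 3) (mollDensity_nonneg_of_pos hr z x₀))) (hpFabs z x₀)
        (abs_nonneg _) hK0
    · rw [abs_mul]; exact mul_le_mul (hK _ (pow_nonneg hσ.le 3)) hΘb' (abs_nonneg _) hK0
  refine ⟨?_, fun x₀ => ?_⟩
  · exact ((measurable_sq_deviation_of_continuous σ N hψm hΞc r (ψ (σ ^ 3) * Θb)).stronglyMeasurable.integral_prod_left'
      (μ := G)).measurable
  · have h := norm_integral_le_of_norm_le_const (μ := G)
      (f := fun z => (ψ (σ ^ 3 * mollDensity r z x₀) * pairFunctional r Ξ z x₀ - ψ (σ ^ 3) * Θb) ^ 2)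
      (C := (K * (M * M * CΘ) + K * CΘ) ^ 2) (ae_of_all _ fun z => by rw [Real.norm_eq_abs]; exact hb z x₀)
    rw [probReal_univ, mul_one, Real.norm_eq_abs] at h
    exact (le_abs_self _).trans h

/-- **The integrated mean-square deviation tends to zero** (general continuous mark with `|Θ Ξ| ≤ C_Θ`):
`∫_{𝕋³} J_N(x₀) dx₀ → 0` (dominated convergence over the compact torus). [folklore] -/
theorem tendsto_integral_integral_sq_deviation_of_abs_sphereMark_le {σ a θ : ℝ} {u : V3}
    (hsd : SmallDensity uniformProfile σ) (ha : 0 < a) (hθ : 0 < θ) {ψ : ℝ → ℝ} (hψm : Measurable ψ) {K : ℝ}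
    (hK : ∀ y, 0 ≤ y → |ψ y| ≤ K) (hψc : ContinuousAt ψ (σ ^ 3)) {Ξ : V3 × V3 × V3 → ℝ} (hΞc : Continuous Ξ)
    {CΘ : ℝ} (hΘb : ∀ v w, |sphereMark Ξ v w| ≤ CΘ) {r : ℝ} (hr : 0 < r) (hr2 : r < 1 / 2)
    (Φ : (N : ℕ) → HardSphereFlow (Torus.geometry (Fin 3)) (hsDiameter σ N) (N + 1)) :
    Tendsto (fun N : ℕ => ∫ x₀ : T3, ∫ z, (ψ (σ ^ 3 * mollDensity r z x₀) * pairFunctional r Ξ z x₀ -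
        ψ (σ ^ 3) * ∫ p, sphereMark Ξ p.1 p.2
          ∂((gaussMeasure u θ).prod (gaussMeasure u θ))) ^ 2
        ∂(localGibbsLaw σ (fun _ => a) (fun _ => u) (fun _ => θ) N (Φ N))) atTop (𝓝 0) := by
  have hσ : 0 < σ := hsd.σ_pos
  have hσ2 : σ ≤ 1 / 2 := hsd.σ_lt_half.le
  set C : ℝ := (K * ((3 / (Real.pi * r ^ 3)) * (3 / (Real.pi * r ^ 3)) * CΘ) + K * CΘ) ^ 2 with hC
  have hml := fun N : ℕ =>
    measurable_integral_sq_deviation_and_le_of_abs_sphereMark_le (u := u) hσ hσ2 ha hθ hψm hK hΞc hΘb hr N (Φ N)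
  have hD := tendsto_integral_of_dominated_convergence (μ := (volume : Measure T3)) (fun _ => C)
    (fun N => (hml N).1.aestronglyMeasurable) (integrable_const C)
    (fun N => ae_of_all _ fun x₀ => by
      rw [Real.norm_eq_abs, abs_of_nonneg (integral_nonneg fun z => sq_nonneg _)]
      exact (hml N).2 x₀)
    (ae_of_all _ fun x₀ => tendsto_integral_sq_deviation_of_abs_sphereMark_le hsd ha hθ hψm hK hψc hΞc hΘb hr hr2 x₀ Φ)
  simpa only [integral_zero] using hD


/-! ## The variance of the Enskog rate functional -/

/-- **Variance of the Enskog rate functional at rung 0, general mark**: under the rung-0 local Gibbs law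
(constant profiles `a, θ > 0`, `u`, `0 < σ ≤ 1/2`), for continuous `χ, g` with `|χ(t, ·)| ≤ C_χ`,
`|g · Y| ≤ K` on `[0, ∞)`, a continuous mark with `|Θ Ξ| ≤ C_Θ` and `r > 0`, the Gibbs variance of the `x`-average
`e_t(z) = ∫ χ(t,x) (g·Y)(σ³ρ_r(z,x)) B_r Ξ (z,x) dx` is at most `C_χ² ∫ J_N(x₀) dx₀`, `J_N` the mean-square deviation
of the Enskog integrand from `(g·Y)(σ³) Θ̄` (`variance_integral_le_integral_integral_sq` with the centring
`χ(t,x) (g·Y)(σ³) Θ̄`, `χ² ≤ C_χ²`). [folklore] -/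
theorem variance_enskogRate_le_sq_mul_integral_sq_deviation {σ a θ : ℝ} {u : V3} (hσ : 0 < σ) (hσ2 : σ ≤ 1 / 2)
    (ha : 0 < a) (hθ : 0 < θ) {χ : ℝ × UnitAddTorus (Fin 3) → ℝ} (hχ : Continuous χ) {Cχ : ℝ} {t : ℝ}
    (hχb : ∀ x, |χ (t, x)| ≤ Cχ) {g : ℝ → ℝ} (hg : Continuous g) {K : ℝ}
    (hK : ∀ y, 0 ≤ y → |g y * contactValue y| ≤ K) {Ξ : V3 × V3 × V3 → ℝ} (hΞc : Continuous Ξ) {CΘ : ℝ}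
    (hΘb : ∀ v w, |sphereMark Ξ v w| ≤ CΘ) {r : ℝ} (hr : 0 < r) (N : ℕ)
    (Φ : HardSphereFlow (Torus.geometry (Fin 3)) (hsDiameter σ N) (N + 1)) :
    variance (fun z => enskogRate σ N χ g Ξ r t z) (localGibbsLaw σ (fun _ => a) (fun _ => u) (fun _ => θ) N Φ) ≤
      Cχ ^ 2 * ∫ x₀ : T3, ∫ z, ((g (σ ^ 3 * mollDensity r z x₀) * contactValue (σ ^ 3 * mollDensity r z x₀)) *
          pairFunctional r Ξ z x₀ - (g (σ ^ 3) * contactValue (σ ^ 3)) *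
            ∫ p, sphereMark Ξ p.1 p.2 ∂((gaussMeasure u θ).prod (gaussMeasure u θ))) ^ 2
        ∂(localGibbsLaw σ (fun _ => a) (fun _ => u) (fun _ => θ) N Φ) := by
  set ψ : ℝ → ℝ := fun b => g b * contactValue b with hψ
  set M : ℝ := 3 / (Real.pi * r ^ 3) with hM
  set G := localGibbsLaw σ (fun _ => a) (fun _ => u) (fun _ => θ) N Φ with hG
  set Θb : ℝ := ∫ p, sphereMark Ξ p.1 p.2 ∂((gaussMeasure u θ).prod (gaussMeasure u θ)) with hΘbdef
  set J : T3 → ℝ := fun x₀ => ∫ z, (ψ (σ ^ 3 * mollDensity r z x₀) * pairFunctional r Ξ z x₀ -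
    ψ (σ ^ 3) * Θb) ^ 2 ∂G with hJdef
  haveI : IsProbabilityMeasure G := isProbabilityMeasure_localGibbsLaw continuous_const
    continuous_const continuous_const (fun _ => ha) (fun _ => hθ) hσ2 N Φ
  have hs : 0 < σ ^ 3 := pow_pos hσ 3
  have hK0 : 0 ≤ K := (abs_nonneg _).trans (hK 0 le_rfl)
  have hCχ0 : 0 ≤ Cχ := (abs_nonneg _).trans (hχb 0)
  have hψm : Measurable ψ := by
    have hY : Measurable contactValue := by
      unfold contactValue
      exact (measurable_deriv _).const_mul _
    exact hg.measurable.mul hY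
  have hΘm : Measurable fun p : V3 × V3 => sphereMark Ξ p.1 p.2 := (continuous_sphereMark_uncurry hΞc).measurable
  have hJml := measurable_integral_sq_deviation_and_le_of_abs_sphereMark_le (u := u) hσ hσ2 ha hθ hψm hK hΞc
    hΘb hr N Φ
  have hJ0 : ∀ x₀, 0 ≤ J x₀ := fun x₀ => integral_nonneg fun z => sq_nonneg _
  have hΘb' : |Θb| ≤ CΘ := abs_integral_sphereMark_le_of_abs_sphereMark_le u θ hΘb
  -- the integrand of `e_t` and its centring
  have hFm : Measurable (Function.uncurry fun (z : Config (N + 1) (Fin 3) T3) (x : T3) =>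
      χ (t, x) * g (σ ^ 3 * mollDensity r z x) * contactValue (σ ^ 3 * mollDensity r z x) *
        pairFunctional r Ξ z x) := by
    have h := (measurable_enskogIntegrand_prod σ N hχ hg hΘm r).comp
      ((measurable_const.prodMk measurable_fst).prodMk measurable_snd :
        Measurable fun q : Config (N + 1) (Fin 3) T3 × T3 => ((t, q.1), q.2))
    exact h
  have hFb : ∀ (z : Config (N + 1) (Fin 3) T3) (x : T3), |χ (t, x) * g (σ ^ 3 * mollDensity r z x) *
      contactValue (σ ^ 3 * mollDensity r z x) * pairFunctional r Ξ z x| ≤ Cχ * (K * (M ^ 2 * CΘ)) := by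
    intro z x
    have e : χ (t, x) * g (σ ^ 3 * mollDensity r z x) * contactValue (σ ^ 3 * mollDensity r z x) *
        pairFunctional r Ξ z x = χ (t, x) * ((g (σ ^ 3 * mollDensity r z x) *
          contactValue (σ ^ 3 * mollDensity r z x)) * pairFunctional r Ξ z x) := by ring
    rw [e, abs_mul, abs_mul]
    exact mul_le_mul (hχb x) (mul_le_mul (hK _ (mul_nonneg hs.le (mollDensity_nonneg_of_pos hr z x)))
      (abs_pairFunctional_le_sq_mul_of_abs_sphereMark_le hΘb hr z x) (abs_nonneg _) hK0)
      (mul_nonneg (abs_nonneg _) (abs_nonneg _)) hCχ0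
  have hmm : Measurable fun x : T3 => χ (t, x) * (ψ (σ ^ 3) * Θb) :=
    (hχ.comp (continuous_const.prodMk continuous_id)).measurable.mul_const _
  have hmb : ∀ x : T3, |χ (t, x) * (ψ (σ ^ 3) * Θb)| ≤ Cχ * (K * CΘ) := fun x => by
    rw [abs_mul, abs_mul]
    exact mul_le_mul (hχb x) (mul_le_mul (hK _ hs.le) hΘb' (abs_nonneg _) hK0)
      (mul_nonneg (abs_nonneg _) (abs_nonneg _)) hCχ0
  have hvar := variance_integral_le_integral_integral_sq (μ := G) (ν := (volume : Measure T3)) hFm hFb hmm hmb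
  have hinner : ∀ x : T3, ∫ z, (χ (t, x) * g (σ ^ 3 * mollDensity r z x) *
      contactValue (σ ^ 3 * mollDensity r z x) * pairFunctional r Ξ z x - χ (t, x) * (ψ (σ ^ 3) * Θb)) ^ 2 ∂G =
      χ (t, x) ^ 2 * J x := fun x => by
    calc _ = ∫ z, χ (t, x) ^ 2 * (ψ (σ ^ 3 * mollDensity r z x) * pairFunctional r Ξ z x -
          ψ (σ ^ 3) * Θb) ^ 2 ∂G := integral_congr_ae (ae_of_all _ fun z => by simp only [hψ]; ring)
      _ = χ (t, x) ^ 2 * J x := integral_const_mul _ _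
  have hJi : Integrable (fun x => Cχ ^ 2 * J x) (volume : Measure T3) :=
    (Integrable.of_bound hJml.1.aestronglyMeasurable _ (ae_of_all _ fun x₀ => by
      rw [Real.norm_eq_abs, abs_of_nonneg (hJ0 x₀)]; exact hJml.2 x₀)).const_mul _
  have hχ2 : ∀ x : T3, χ (t, x) ^ 2 ≤ Cχ ^ 2 := fun x => by
    rw [← sq_abs]; exact pow_le_pow_left₀ (abs_nonneg _) (hχb x) 2
  calc variance (fun z => enskogRate σ N χ g Ξ r t z) G
      ≤ ∫ x, ∫ z, (χ (t, x) * g (σ ^ 3 * mollDensity r z x) * contactValue (σ ^ 3 * mollDensity r z x) *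
          pairFunctional r Ξ z x - χ (t, x) * (ψ (σ ^ 3) * Θb)) ^ 2 ∂G := hvar
    _ = ∫ x, χ (t, x) ^ 2 * J x := integral_congr_ae (ae_of_all _ hinner)
    _ ≤ ∫ x, Cχ ^ 2 * J x :=
        integral_mono_of_nonneg (ae_of_all _ fun x => mul_nonneg (sq_nonneg _) (hJ0 x)) hJi
          (ae_of_all _ fun x => mul_le_mul_of_nonneg_right (hχ2 x) (hJ0 x))
    _ = Cχ ^ 2 * ∫ x, J x := integral_const_mul _ _

end Literature.MathematicalPhysics.KineticTheory

end
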